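import Literature.NumberTheory.BeurlingPrimes.RiemannPrimeCountPsi
import Literature.NumberTheory.BeurlingPrimes.ErrorExponents
import Mathlib.MeasureTheory.Integral.IntervalIntegral.FundThmCalculus
import Mathlib.MeasureTheory.Integral.DominatedConvergence
import Mathlib.Analysis.Calculus.Deriv.MeanValue
import Mathlib.Analysis.SpecialFunctions.Pow.Asymptotics
import Mathlib.Analysis.SpecialFunctions.Log.Deriv
import HarnessLib

/-!
# `Li(x) log x − ∫₁ˣ Li(u) du/u = x − 1 − log x`, and `Π_P = Li + O(log log x) ⟹ ψ_P = x + O_ε(x^ε)`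

Topic `Literature/NumberTheory/BeurlingPrimes`. Everything in this file is PROVED.

`Li(x) = ∫₁ˣ (1 − u⁻¹)/log u du` (`WellBehavedSystems.lean`, the BV/BDR normalisation). We prove:

* `Li_nonneg`, `Li_monotoneOn`, `continuousOn_Li`, `hasDerivAt_Li` (`Li′(x) = (1 − x⁻¹)/log x`, `x > 1`;
  the integrand is continuous on `(1, ∞)` with values in `[0, 1]`);
* `Li_mul_log_sub_integral` — `∫₁ˣ log u dLi(u) = Li(x) log x − ∫₁ˣ Li(u) u⁻¹ du = x − 1 − log x` (BDR, proof
  of Theorem 3.2: "`∫_1^x log u dLi(u^z) = (x^z − 1)/z − log x`" at `z = 1`), by the mean value theorem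
  applied to the difference (derivative `0` on `(1, x)`, continuous on `[1, x]`);
* `abs_chebyshevPsi_sub_self_le` — if `|Π_P(x) − Li(x)| ≤ C log log x` on `[3, ∞)` then
  `|ψ_P(x) − x| ≤ K log x · log log x` on `[3, ∞)`, combining the two Abel identities
  (`RiemannPrimeCountPsi.lean`);
* `primeErrorLE_of_riemannPrimeCount_sub_Li` — hence `ψ_P(x) = x + O_ε(x^ε)` for every `ε > 0`: the primes of the
  Broucke–Vindas `[0, 1/2]`-system (`BrouckeVindas2024_thm31`) are `0`-well-behaved (BDR Cor. 3.4, `α = 0`).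

## References
* [BrouckeDebruyneRevesz2023] F. Broucke, G. Debruyne, Sz. Gy. Révész, *Some examples of well-behaved Beurling
  number systems*, arXiv:2309.01567, §2 (`Li`), proof of Theorem 3.2 and of Corollary 3.4.
* [BrouckeVindas2024] F. Broucke, J. Vindas, *A new generalized prime random approximation procedure and some of
  its applications*, Math. Z. 307 (2024), Theorem 3.1 (`Π_𝒫(x) = Li(x) + O(log log x)`).
-/

noncomputable section

open Filter Set MeasureTheory intervalIntegral Asymptotics
open scoped Topology Interval

namespace Literature.NumberTheory.BeurlingPrimes

open Literature.Barriers.RiemannHypothesis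

/-! ### The integrand of `Li` -/

/-- `0 ≤ (1 − u⁻¹)/log u` for `u > 1`. [folklore] -/
theorem Li_integrand_nonneg {u : ℝ} (hu : 1 < u) : 0 ≤ (1 - u⁻¹) / Real.log u :=
  div_nonneg (sub_nonneg.mpr (inv_le_one_of_one_le₀ hu.le)) (Real.log_nonneg hu.le)

/-- `(1 − u⁻¹)/log u ≤ 1` for `u > 1` (`1 − u⁻¹ ≤ log u`). [folklore] -/
theorem Li_integrand_le_one {u : ℝ} (hu : 1 < u) : (1 - u⁻¹) / Real.log u ≤ 1 := by
  rw [div_le_one (Real.log_pos hu)]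
  exact Real.one_sub_inv_le_log_of_pos (by linarith)

/-- The integrand of `Li` is continuous on `(1, ∞)`. [folklore] -/
theorem continuousOn_Li_integrand : ContinuousOn (fun u : ℝ ↦ (1 - u⁻¹) / Real.log u) (Ioi 1) := by
  refine ContinuousOn.div ?_ ?_ fun u hu ↦ (Real.log_pos hu).ne'
  · exact continuousOn_const.sub (continuousOn_inv₀.mono fun u hu ↦ ne_of_gt (lt_trans one_pos hu))
  · exact Real.continuousOn_log.mono fun u hu ↦ ne_of_gt (lt_trans one_pos hu)

/-- The integrand of `Li` is interval integrable on `[1, x]` (bounded by `1`, continuous on `(1, x]`). [folklore] -/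
theorem intervalIntegrable_Li_integrand {x : ℝ} (hx : 1 ≤ x) :
    IntervalIntegrable (fun u : ℝ ↦ (1 - u⁻¹) / Real.log u) volume 1 x := by
  rw [intervalIntegrable_iff_integrableOn_Ioc_of_le hx]
  have hconst : IntegrableOn (fun _ : ℝ ↦ (1 : ℝ)) (Ioc 1 x) volume := integrableOn_const measure_Ioc_lt_top.ne
  refine hconst.mono' ?_ ?_
  · exact (continuousOn_Li_integrand.mono Ioc_subset_Ioi_self).aestronglyMeasurable measurableSet_Ioc
  · refine (ae_restrict_iff' measurableSet_Ioc).mpr (Eventually.of_forall fun u hu ↦ ?_)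
    rw [Real.norm_eq_abs, abs_of_nonneg (Li_integrand_nonneg hu.1)]
    exact Li_integrand_le_one hu.1

/-! ### Basic properties of `Li` on `[1, ∞)` -/

/-- `Li(y) − Li(x) = ∫ₓʸ (1 − u⁻¹)/log u du` for `1 ≤ x ≤ y`. [folklore] -/
theorem Li_sub_Li {x y : ℝ} (hx : 1 ≤ x) (hxy : x ≤ y) :
    Li y - Li x = ∫ u in x..y, (1 - u⁻¹) / Real.log u := by
  unfold Li
  exact intervalIntegral.integral_interval_sub_left (intervalIntegrable_Li_integrand (hx.trans hxy))
    (intervalIntegrable_Li_integrand hx)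

/-- `Li` is non-decreasing on `[1, ∞)`. [folklore] -/
theorem Li_monotoneOn : MonotoneOn Li (Ici 1) := by
  intro x hx y _ hxy
  have h := Li_sub_Li hx hxy
  have h2 : 0 ≤ ∫ u in x..y, (1 - u⁻¹) / Real.log u := by
    refine intervalIntegral.integral_nonneg hxy fun u hu ↦ ?_
    rcases eq_or_lt_of_le (show (1 : ℝ) ≤ u from hx.trans hu.1) with h1 | h1
    · rw [← h1]; simp
    · exact Li_integrand_nonneg h1
  linarith

/-- `Li ≥ 0` on `[1, ∞)`. [folklore] -/
theorem Li_nonneg {x : ℝ} (hx : 1 ≤ x) : 0 ≤ Li x := by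
  have := Li_monotoneOn (Set.self_mem_Ici) (Set.mem_Ici.mpr hx) hx
  rwa [Li_one] at this

/-- `Li` is continuous on `[1, X]`. [folklore] -/
theorem continuousOn_Li (X : ℝ) : ContinuousOn Li (Icc 1 X) := by
  rcases le_or_gt 1 X with hX | hX
  · have h := intervalIntegral.continuousOn_primitive_interval' (intervalIntegrable_Li_integrand hX)
      (show (1 : ℝ) ∈ uIcc 1 X from left_mem_uIcc)
    rw [uIcc_of_le hX] at h
    exact h
  · rw [Icc_eq_empty (not_le.mpr hX)]
    exact continuousOn_empty _

/-- `Li′(x) = (1 − x⁻¹)/log x` for `x > 1`. [cite: BrouckeDebruyneRevesz2023, §2] -/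
theorem hasDerivAt_Li {x : ℝ} (hx : 1 < x) : HasDerivAt Li ((1 - x⁻¹) / Real.log x) x := by
  have hmeas := ContinuousOn.stronglyMeasurableAtFilter (μ := volume) isOpen_Ioi continuousOn_Li_integrand x hx
  have hcont : ContinuousAt (fun u : ℝ ↦ (1 - u⁻¹) / Real.log u) x :=
    continuousOn_Li_integrand.continuousAt (isOpen_Ioi.mem_nhds hx)
  exact intervalIntegral.integral_hasDerivAt_right (intervalIntegrable_Li_integrand hx.le) hmeas hcont

/-- `u ↦ Li(u)/u` is continuous on `[1, X]`. [folklore] -/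
theorem continuousOn_Li_div (X : ℝ) : ContinuousOn (fun u ↦ Li u / u) (Icc 1 X) :=
  (continuousOn_Li X).div continuousOn_id fun _ hu ↦ ne_of_gt (lt_of_lt_of_le one_pos hu.1)

/-- `u ↦ Li(u)/u` is interval integrable on `[1, x]`. [folklore] -/
theorem intervalIntegrable_Li_div {x : ℝ} (hx : 1 ≤ x) : IntervalIntegrable (fun u ↦ Li u / u) volume 1 x := by
  refine ContinuousOn.intervalIntegrable ?_
  rw [uIcc_of_le hx]
  exact continuousOn_Li_div x

/-! ### The Abel identity for `Li` -/

/-- **`∫₁ˣ log u dLi(u) = x − 1 − log x`**, in the form `Li(x) log x − ∫₁ˣ Li(u) u⁻¹ du = x − 1 − log x`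
(`x ≥ 1`). [cite: BrouckeDebruyneRevesz2023, proof of Theorem 3.2] -/
theorem Li_mul_log_sub_integral {x : ℝ} (hx : 1 ≤ x) :
    Li x * Real.log x - ∫ u in (1 : ℝ)..x, Li u / u = x - 1 - Real.log x := by
  rcases hx.eq_or_lt with h1 | h1
  · rw [← h1]; simp
  -- `G(y) = Li(y) log y − ∫₁ʸ Li/u − (y − 1 − log y)` is continuous on `[1,x]` with derivative `0` on `(1,x)`
  set G : ℝ → ℝ := fun y ↦ Li y * Real.log y - (∫ u in (1 : ℝ)..y, Li u / u) - (y - 1 - Real.log y) with hG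
  have hlog : ContinuousOn Real.log (Icc 1 x) :=
    Real.continuousOn_log.mono fun u hu ↦ ne_of_gt (lt_of_lt_of_le one_pos hu.1)
  have hGc : ContinuousOn G (Icc 1 x) := by
    refine ((continuousOn_Li x).mul hlog).sub ?_ |>.sub ((continuousOn_id.sub continuousOn_const).sub hlog)
    have h := intervalIntegral.continuousOn_primitive_interval' (intervalIntegrable_Li_div hx)
      (show (1 : ℝ) ∈ uIcc 1 x from left_mem_uIcc)
    rw [uIcc_of_le hx] at h
    exact h
  have hGd : ∀ y ∈ Ioo 1 x, HasDerivAt G 0 y := by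
    intro y hy
    have hy0 : 0 < y := lt_trans one_pos hy.1
    have hlogy : Real.log y ≠ 0 := (Real.log_pos hy.1).ne'
    have h1 : HasDerivAt Li ((1 - y⁻¹) / Real.log y) y := hasDerivAt_Li hy.1
    have h2 : HasDerivAt Real.log y⁻¹ y := Real.hasDerivAt_log hy0.ne'
    have h3 : HasDerivAt (fun z ↦ ∫ u in (1 : ℝ)..z, Li u / u) (Li y / y) y := by
      have hco : ContinuousOn (fun u ↦ Li u / u) (Ioo 1 x) := (continuousOn_Li_div x).mono Ioo_subset_Icc_self
      exact intervalIntegral.integral_hasDerivAt_right (intervalIntegrable_Li_div hy.1.le)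
        (hco.stronglyMeasurableAtFilter (μ := volume) isOpen_Ioo y hy) (hco.continuousAt (Ioo_mem_nhds hy.1 hy.2))
    have h4 : HasDerivAt G (((1 - y⁻¹) / Real.log y * Real.log y + Li y * y⁻¹) - Li y / y - (1 - y⁻¹)) y :=
      ((h1.mul h2).sub h3).sub ((hasDerivAt_id y |>.sub_const 1).sub h2)
    convert h4 using 1
    field_simp
    ring
  obtain ⟨c, _, hc⟩ := exists_hasDerivAt_eq_slope G (fun _ ↦ 0) h1 hGc hGd
  have hG1 : G 1 = 0 := by simp [hG]
  have hGx : G x = 0 := by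
    rw [eq_comm, div_eq_iff (show x - 1 ≠ 0 by linarith), zero_mul] at hc
    linarith
  simpa [hG, sub_eq_zero] using hGx

/-! ### From `Π_P = Li + O(log log x)` to `ψ_P = x + O(log x · log log x)` -/

section transfer

variable (P : BeurlingPrimes)

/-- `ψ_P(x) − (x − 1 − log x) = (Π_P − Li)(x) log x − ∫₁ˣ (Π_P − Li)(u) u⁻¹ du` (`x ≥ 1`): the difference of the
two Abel identities. [cite: BrouckeDebruyneRevesz2023, proof of Theorem 3.2] -/
theorem _root_.Literature.Barriers.RiemannHypothesis.BeurlingPrimes.chebyshevPsi_sub_eq_riemannPrimeCount_sub_Li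
    {x : ℝ} (hx : 1 ≤ x) :
    P.chebyshevPsi x - (x - 1 - Real.log x) = (P.riemannPrimeCount x - Li x) * Real.log x -
      ∫ u in (1 : ℝ)..x, (P.riemannPrimeCount u - Li u) / u := by
  rw [P.chebyshevPsi_eq_riemannPrimeCount_mul_log_sub_integral hx, ← Li_mul_log_sub_integral hx]
  have : ∫ u in (1 : ℝ)..x, (P.riemannPrimeCount u - Li u) / u
      = (∫ u in (1 : ℝ)..x, P.riemannPrimeCount u / u) - ∫ u in (1 : ℝ)..x, Li u / u := by
    simp_rw [sub_div]
    exact intervalIntegral.integral_sub (P.intervalIntegrable_riemannPrimeCount_div hx)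
      (intervalIntegrable_Li_div hx)
  rw [this]
  ring

/-- **`Π_P(x) = Li(x) + O(log log x)` implies `ψ_P(x) = x + O(log x log log x)`** (global bounds on `[3, ∞)`):
`|ψ_P(x) − x| ≤ 1 + log x + |Π_P − Li|(x) log x + ∫₁³ |Π_P − Li| + ∫₃ˣ C log log x du/u`. (The printed proof of
Cor. 3.4, `α = 0`, takes `M = 0`, `ℛ = 𝒮 = ∅` inside the proof of Thm. 3.2; the tree realises that example through
BV 2024, Thm. 3.1 = `BrouckeVindas2024_thm31`, whose first clause is the hypothesis here.)
[cite: BrouckeDebruyneRevesz2023, proof of Corollary 3.4] -/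
theorem _root_.Literature.Barriers.RiemannHypothesis.BeurlingPrimes.abs_chebyshevPsi_sub_self_le {C : ℝ}
    (h : ∀ x : ℝ, 3 ≤ x → |P.riemannPrimeCount x - Li x| ≤ C * Real.log (Real.log x)) :
    ∃ K : ℝ, ∀ x : ℝ, 3 ≤ x → |P.chebyshevPsi x - x| ≤ K * (Real.log x * Real.log (Real.log x)) := by
  set M : ℝ := P.riemannPrimeCount 3 + Li 3 with hM
  have hM0 : 0 ≤ M := add_nonneg (P.riemannPrimeCount_nonneg 3) (Li_nonneg (by norm_num))
  set C' : ℝ := max C 0 with hC'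
  have hC'0 : 0 ≤ C' := le_max_right _ _
  have one_lt_log_three : 1 < Real.log 3 := by
    rw [Real.lt_log_iff_exp_lt (by norm_num)]
    have := Real.exp_one_lt_d9
    linarith
  set m₀ : ℝ := Real.log (Real.log 3) with hm₀
  have hm₀0 : 0 < m₀ := Real.log_pos one_lt_log_three
  refine ⟨(2 + 2 * M) / m₀ + 2 * C', fun x hx ↦ ?_⟩
  have hx1 : (1 : ℝ) ≤ x := by linarith
  set L := Real.log x with hL
  set LL := Real.log (Real.log x) with hLL
  have hL3 : Real.log 3 ≤ L := Real.log_le_log (by norm_num) hx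
  have hL1 : 1 ≤ L := one_lt_log_three.le.trans hL3
  have hLL0 : m₀ ≤ LL := Real.log_le_log (by linarith [one_lt_log_three]) hL3
  have hLLpos : 0 < LL := hm₀0.trans_le hLL0
  -- the bound on `[1, 3]`
  have hΔ13 : ∀ u ∈ Ι (1 : ℝ) 3, ‖(P.riemannPrimeCount u - Li u) / u‖ ≤ M := by
    intro u hu
    rw [uIoc_of_le (by norm_num)] at hu
    have hu0 : 0 < u := by linarith [hu.1]
    rw [Real.norm_eq_abs, abs_div, abs_of_pos hu0]
    have h1 : |P.riemannPrimeCount u - Li u| ≤ M := by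
      rw [abs_le]
      have := P.riemannPrimeCount_nonneg u
      have := P.riemannPrimeCount_mono hu.2
      have := Li_nonneg hu.1.le
      have := Li_monotoneOn (show u ∈ Ici (1 : ℝ) from hu.1.le) (show (3 : ℝ) ∈ Ici 1 by norm_num) hu.2
      constructor <;> linarith
    calc |P.riemannPrimeCount u - Li u| / u ≤ |P.riemannPrimeCount u - Li u| / 1 :=
          div_le_div_of_nonneg_left (abs_nonneg _) one_pos hu.1.le
      _ ≤ M := by rw [div_one]; exact h1
  -- the bound on `[3, x]`
  have hΔ3x : ∀ᵐ u : ℝ, u ∈ Ioc (3 : ℝ) x → ‖(P.riemannPrimeCount u - Li u) / u‖ ≤ C' * LL * u⁻¹ := by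
    refine Eventually.of_forall fun u hu ↦ ?_
    have hu0 : 0 < u := by linarith [hu.1]
    rw [Real.norm_eq_abs, abs_div, abs_of_pos hu0, div_eq_mul_inv]
    refine mul_le_mul_of_nonneg_right ?_ (inv_nonneg.mpr hu0.le)
    have hlu : Real.log (Real.log u) ≤ LL :=
      Real.log_le_log (by linarith [one_lt_log_three, Real.log_le_log (by norm_num) hu.1.le])
        (Real.log_le_log hu0 hu.2)
    have hlu0 : 0 ≤ Real.log (Real.log u) :=
      Real.log_nonneg (one_lt_log_three.le.trans (Real.log_le_log (by norm_num) hu.1.le))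
    calc |P.riemannPrimeCount u - Li u| ≤ C * Real.log (Real.log u) := h u hu.1.le
      _ ≤ C' * Real.log (Real.log u) := mul_le_mul_of_nonneg_right (le_max_left _ _) hlu0
      _ ≤ C' * LL := mul_le_mul_of_nonneg_left hlu hC'0
  have hint13 : IntervalIntegrable (fun u ↦ (P.riemannPrimeCount u - Li u) / u) volume 1 3 := by
    simp_rw [sub_div]
    exact (P.intervalIntegrable_riemannPrimeCount_div (by norm_num)).sub (intervalIntegrable_Li_div (by norm_num))
  have hint3x : IntervalIntegrable (fun u ↦ (P.riemannPrimeCount u - Li u) / u) volume 3 x := by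
    have h1x : IntervalIntegrable (fun u ↦ (P.riemannPrimeCount u - Li u) / u) volume 1 x := by
      simp_rw [sub_div]
      exact (P.intervalIntegrable_riemannPrimeCount_div hx1).sub (intervalIntegrable_Li_div hx1)
    exact (hint13.symm.trans h1x)
  have hI13 : ‖∫ u in (1 : ℝ)..3, (P.riemannPrimeCount u - Li u) / u‖ ≤ M * |3 - 1| :=
    intervalIntegral.norm_integral_le_of_norm_le_const hΔ13
  have hinv : IntervalIntegrable (fun u : ℝ ↦ C' * LL * u⁻¹) volume 3 x := by
    refine (ContinuousOn.intervalIntegrable ?_)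
    rw [uIcc_of_le hx]
    exact continuousOn_const.mul (continuousOn_inv₀.mono fun u hu ↦ ne_of_gt (by linarith [hu.1]))
  have hI3x : ‖∫ u in (3 : ℝ)..x, (P.riemannPrimeCount u - Li u) / u‖ ≤ C' * LL * L := by
    refine (intervalIntegral.norm_integral_le_of_norm_le hx hΔ3x hinv).trans ?_
    have h0 : (0 : ℝ) ∉ uIcc 3 x := by rw [uIcc_of_le hx]; exact fun h ↦ by linarith [h.1]
    rw [intervalIntegral.integral_const_mul, integral_inv h0]
    refine mul_le_mul_of_nonneg_left ?_ (by positivity)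
    rw [Real.log_div (by linarith) (by norm_num)]
    linarith [Real.log_nonneg (show (1 : ℝ) ≤ 3 by norm_num)]
  -- assemble
  have hsplit : ∫ u in (1 : ℝ)..x, (P.riemannPrimeCount u - Li u) / u =
      (∫ u in (1 : ℝ)..3, (P.riemannPrimeCount u - Li u) / u) + ∫ u in (3 : ℝ)..x, (P.riemannPrimeCount u - Li u) / u :=
    (intervalIntegral.integral_add_adjacent_intervals hint13 hint3x).symm
  have hid := P.chebyshevPsi_sub_eq_riemannPrimeCount_sub_Li hx1
  have hmain : |(P.riemannPrimeCount x - Li x) * L| ≤ C' * LL * L := by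
    rw [abs_mul, abs_of_nonneg (by linarith : 0 ≤ L)]
    refine mul_le_mul_of_nonneg_right ((h x hx).trans ?_) (by linarith)
    exact mul_le_mul_of_nonneg_right (le_max_left _ _) hLLpos.le
  rw [Real.norm_eq_abs] at hI13 hI3x
  have habs : |P.chebyshevPsi x - x| ≤ 1 + L + C' * LL * L + (M * 2 + C' * LL * L) := by
    have e : P.chebyshevPsi x - x = -1 - L + ((P.riemannPrimeCount x - Li x) * L -
        ((∫ u in (1 : ℝ)..3, (P.riemannPrimeCount u - Li u) / u) +
          ∫ u in (3 : ℝ)..x, (P.riemannPrimeCount u - Li u) / u)) := by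
      rw [← hsplit]; linarith
    rw [e]
    have h2 : |(3 : ℝ) - 1| = 2 := by norm_num
    rw [h2] at hI13
    calc |-1 - L + ((P.riemannPrimeCount x - Li x) * L -
          ((∫ u in (1 : ℝ)..3, (P.riemannPrimeCount u - Li u) / u) +
            ∫ u in (3 : ℝ)..x, (P.riemannPrimeCount u - Li u) / u))|
        ≤ |-1 - L| + |(P.riemannPrimeCount x - Li x) * L -
          ((∫ u in (1 : ℝ)..3, (P.riemannPrimeCount u - Li u) / u) +
            ∫ u in (3 : ℝ)..x, (P.riemannPrimeCount u - Li u) / u)| := abs_add_le _ _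
      _ ≤ (1 + L) + (C' * LL * L + (M * 2 + C' * LL * L)) := by
          gcongr
          · rw [abs_le]; constructor <;> linarith
          · refine (abs_sub _ _).trans (add_le_add hmain ((abs_add_le _ _).trans (add_le_add hI13 hI3x)))
      _ = 1 + L + C' * LL * L + (M * 2 + C' * LL * L) := by ring
  -- `1 + L + 2M ≤ ((2 + 2M)/m₀) · L · LL`
  have hlow : 1 + L + M * 2 ≤ (2 + 2 * M) / m₀ * (L * LL) := by
    rw [div_mul_eq_mul_div, le_div_iff₀ hm₀0]
    have h1 : m₀ ≤ L * LL := by nlinarith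
    nlinarith
  calc |P.chebyshevPsi x - x| ≤ 1 + L + C' * LL * L + (M * 2 + C' * LL * L) := habs
    _ = (1 + L + M * 2) + 2 * C' * (L * LL) := by ring
    _ ≤ (2 + 2 * M) / m₀ * (L * LL) + 2 * C' * (L * LL) := by linarith
    _ = ((2 + 2 * M) / m₀ + 2 * C') * (L * LL) := by ring

/-- **BDR Corollary 3.4, `α = 0`, the primes** (via BV 2024, Thm. 3.1): if `Π_P(x) = Li(x) + O(log log x)` then
the primes of `P` are `0`-well-behaved, `ψ_P(x) = x + O_ε(x^ε)` for every `ε > 0`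
(`log x log log x ≤ (log x)² = o(x^ε)`). [cite: BrouckeDebruyneRevesz2023, proof of Corollary 3.4] -/
theorem _root_.Literature.Barriers.RiemannHypothesis.BeurlingPrimes.primeErrorLE_of_riemannPrimeCount_sub_Li
    {C : ℝ} (h : ∀ x : ℝ, 3 ≤ x → |P.riemannPrimeCount x - Li x| ≤ C * Real.log (Real.log x)) {ε : ℝ}
    (hε : 0 < ε) : P.PrimeErrorLE ε := by
  have one_lt_log_three : 1 < Real.log 3 := by
    rw [Real.lt_log_iff_exp_lt (by norm_num)]
    have := Real.exp_one_lt_d9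
    linarith
  obtain ⟨K, hK⟩ := P.abs_chebyshevPsi_sub_self_le h
  have hK0 : 0 ≤ K := by
    have h3 := hK 3 le_rfl
    have hp : 0 < Real.log 3 * Real.log (Real.log 3) :=
      mul_pos (by linarith [one_lt_log_three]) (Real.log_pos one_lt_log_three)
    by_contra hneg
    push Not at hneg
    nlinarith [abs_nonneg (P.chebyshevPsi 3 - 3)]
  have hev : ∀ᶠ x : ℝ in atTop, Real.log x ^ (2 : ℝ) ≤ x ^ ε := by
    filter_upwards [(isLittleO_log_rpow_rpow_atTop (2 : ℝ) hε).bound one_pos, eventually_ge_atTop (1 : ℝ)]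
      with x hx hx1
    rw [one_mul, Real.norm_eq_abs, Real.norm_eq_abs, abs_of_nonneg (Real.rpow_nonneg (Real.log_nonneg hx1) _),
      abs_of_nonneg (Real.rpow_nonneg (by linarith) _)] at hx
    exact hx
  obtain ⟨X, hX⟩ := (hev.and (eventually_ge_atTop (3 : ℝ))).exists_forall_of_atTop
  refine P.primeErrorLE_of_forall_ge hε.le (X := X) (C := K) fun x hx ↦ ?_
  obtain ⟨h1, h3⟩ := hX x hx
  have hL0 : 0 < Real.log x := by linarith [one_lt_log_three, Real.log_le_log (by norm_num) h3]
  have hLL : Real.log (Real.log x) ≤ Real.log x := by linarith [Real.log_le_sub_one_of_pos hL0]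
  calc |P.chebyshevPsi x - x| ≤ K * (Real.log x * Real.log (Real.log x)) := hK x h3
    _ ≤ K * Real.log x ^ (2 : ℝ) := by
        refine mul_le_mul_of_nonneg_left ?_ hK0
        rw [Real.rpow_two, sq]
        exact mul_le_mul_of_nonneg_left hLL hL0.le
    _ ≤ K * x ^ ε := mul_le_mul_of_nonneg_left h1 hK0

end transfer

end Literature.NumberTheory.BeurlingPrimes
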